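import Summits.QuantumFields.YangMills.Theorems.BalabanUVNodesN21ExponentialChartFieldStrength
import Summits.QuantumFields.YangMills.Theorems.BalabanUVNodesN21AnalyticResponseRemainder

/-!
# N21 (NE7c) · THE RESPONSE ROAD END TO END AT THE REGULAR SET: part 34's radial-transversality binder `hRT` and
# its (M1) for the cube sup of plaquette readings of the minimiser THROUGH THE EXPONENTIAL BLOCK CHART, from ONE
# NODE-O-shaped clause — «`Ψ` differentiable with a sup bound on the regular set» (W-SEAT START-LIST v8 §n21)

Width seat `pub-ymgap-dag-n21-w3` (g2), node N21 = NE7c (NOT PRINTED in [Bałaban 1983–89], NOT proved), lane K3⁷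
`SpineGivenEndpointR13SepCoPH` (stmt-QuantumFields-20544, `--kind proof --supports … --as helper`).  File 8 of this
seat's response road; consumes BY NAME file 7 `…N21ExponentialChartFieldStrength` (★ `plaqReading_sub_le_of_units`,
`bond_letters_of_near_units`, §3 chart-value letters, `differentiableOn_plaqReading`), file 5
`…N21ExponentialChartResponse` (p592163: `differentiable_blockExpChart`, `blockExpChart_lipschitz`), file 4
`…N21ResponseRungNumeralAtThm1Letters` (p590159: §0 `responseLetters_of_chart`) and file 2
`…N21AnalyticResponseRemainder` (p585983: ★ `hRT_of_analyticResponse`, ★★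
`slotAntiConcentration_restrict_of_projectedCentre_analyticResponse`).

WHY.  Files 1–7 leave the response road with three ★★ sockets keyed to letters (`hd`, `hB` per cut point; the chart
letters `ℓ`, `c_B`; the domain inclusion).  THIS FILE closes the road into ONE socket keyed to the SHAPE of NODE O's
object: for every fine plaquette `q` and exterior `z`, the plaquette reading `Ψ q z` of the minimiser, as a function
of the block's configuration `B → 𝔄`, is complex differentiable on the REGULAR SET
`Reg ε = {V | (∀ b, IsUnit (V b)) ∧ ∀ p ∈ plaqs, ‖∂V(p) − 1‖ < ε}` with `‖Ψ q z‖ ≤ S` there ([B11] = CMP 102 (1985)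
277, Theorem 1 p. 279 — existence, bound (8) `|U_k(∂p) − 1| < B₃ε₁η²`, for `ε₁`-regular data (7); [RG1] = [B12] =
CMP 109 (1987) 249, Lemma 4 p. 280 ∕ (1.15)–(1.16) p. 262 — analytic dependence on the complex regular spaces
(1.11)–(1.14); `ε ↔ a₁`, `S ↔ B₃εσ`: a located DICTIONARY, not asserted).  Given that clause, the chart data
(`Σ_a‖X_a(b)‖ ≤ Ξ`, `‖V₀(b)‖ ≤ v`, `‖V₀(b)⁻¹‖ ≤ v′`, uniformly in `z`), a bound `‖x‖ ≤ ϱ` on the kept cut,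
`δ`-regularity of the base configurations `χ_z(x)` at the cut points ((L1)∕(L3): the data in the cut are regular),
the SMALLNESS `ℓ̄r·v′e^{ϱΞ} ≤ ½` and the FIELD-STRENGTH BUDGET `δ + c̄·ℓ̄r < ε` (`ℓ̄ = Ξe^{(ϱ+r)Ξ}v`,
`c̄ = max(e^{ϱΞ}v + ℓ̄r, 2v′e^{ϱΞ})³(2 + 4(v′e^{ϱΞ})²)` — all FORMULAS), file 2's letters hold with `B = 2S` at
EVERY cut point, hence part 34's `hRT` (★★★) and its (M1) (★★★★) for the tested variable
`U p = ⨆_q ‖Ψ q p.1 (χ_{p.1}(p.2))‖` under the numeral `c₀ + 4(4S∕r²)R² ≤ (1 − κ₀)θ(1 − ρ)` and part 34's other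
binders displayed unchanged.

WHAT IS PROVED ([textbook]∕[bookkeeping]; 0 def, 0 sorry; `χ_z(w) = (b ↦ exp(Σ_a w_a•X_z a b)·V₀ z b)` written out).
* §1 ★ `fieldStrength_closedBall_blockExpChart_of_norm_le`: file 7 §4 with constants read at a bound `ϱ ≥ ‖x‖`
  (uniform over the cut).
* §2 ★★ `responseLetters_of_blockExpChart_regular_of_norm_le`: file 7 §6 with `ℓ̄`, `c̄` at `ϱ` (uniform letters).
* §3 ★★★ `hRT_of_blockExpChart_regular`: part 34's binder `hRT` VERBATIM (up to β-reduction — kernel-checked by the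
  bare `exact` in §4) for `U p = ⨆_q ‖Ψ q p.1 (χ_{p.1}(ι p.2))‖` (`ι` the real-to-complex embedding of the block frame).
* §4 ★★★★ `slotAntiConcentration_restrict_of_projectedCentre_blockExpChart_regular`: part 34's (M1)
  `SlotAntiConcentration (ν|({U<θ} ∩ C)) U θ ρ (3(#κ+1)(1+Q)∕(κ₀(1−ρ)))` with `hRT` DISCHARGED by §3; the remaining
  binders (coercivity, Lipschitz cut action, obtuseness, farness, envelope, odds, measurability) displayed unchanged.
  Their «own sanity files» (§4's docstring) are: this seat's `…N21ResponseRadialTransversalitySanity` (p589278, v1.1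
  p603813: the JOINT part-34 binder system about the projected centre inhabited on a model, slope-3 witness) and
  `…N21ResponseRoadAtRegularSetSanity` (p600431: §3's ★★★ system on an explicit model with a non-empty shell and a
  genuine dilate), and dag-n21-d's `…N21DilationHazardSanity` (Gaussian weight ∕ cube statistic for the dilation road's
  parts 16 ∕ 18).
* §5 A2∕A6 `fieldStrength_reading_admissible`: the NODE-O-shaped clause is inhabited NON-TRIVIALLY in every `𝔄`:
  the field strength itself, `Ψ(V) = ∂V(p) − 1` (`p ∈ plaqs`), is complex differentiable on `Reg ε` (file 7
  `differentiableOn_plaqReading`) with sup bound `ε` there — the level-0 instance of the tested variable.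
* §6 `measurable_cubeSup_blockExpChart`: the `hUm` supplier — the cube sup `p ↦ ⨆_q ‖Ψ q p.1 (χ_{p.1}(ι p.2))‖` is
  measurable when each reading through the chart is (`Measurable.iSup` over the countable plaquette index).
(v1.1, dag-n21-w3 g4: WHAT IS PROVED gains the §6 bullet, names the sanity files §4 refers to, and qualifies «VERBATIM»
— ref-O g6 READ-150 NITs; declarations unchanged.)

HONEST FRAMING.  [textbook]∕[bookkeeping] composition BY NAME; the NODE-O clause, the base regularity, the numeral and
part 34's binders are displayed HYPOTHESES; the dictionary (`ε ↔ a₁`, `δ ↔ ε₁`, `S ↔ B₃εσ`, `θ ↔ ε₀σ`, `χ ↔` print's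
charts (1.12)–(1.13) ∕ (2.21)) is located, NOT asserted, NOT typed at NODE 00's objects (`Node00.UbgOfRecord`);
nothing of Bałaban's asserted; (M1) NOT PRINTED ∕ NOT proved; NE7c NOT PRINTED ∕ NOT proved; N21 NOT discharged; K3⁷
NOT claimed; counts unmoved (typed 28∕28 · discharged 5∕27); count-neutral; one finite 𝕋⁴ at fixed ε — YM mass gap
(Clay) is NOT proved by any of this: R4 closes the conditional finite-𝕋⁴ rung `BalabanLadder.UV` only; nothing
continuum ∕ ℝ⁴ ∕ OS ∕ mass gap ∕ Clay.
-/

noncomputable section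

open NormedSpace Metric Set MeasureTheory Matrix
open scoped ENNReal

namespace Summit.QuantumFields.YangMills.Theorems.N21ResponseRoadAtRegularSet

open Literature.MathematicalPhysics.QuantumFieldTheory.Balaban1983to89.T4ShellMeasure (SlotAntiConcentration)
open Summit.QuantumFields.YangMills.Theorems.N21ExponentialChartResponse
  (norm_blockExponent_le differentiable_blockExpChart blockExpChart_lipschitz)
open Summit.QuantumFields.YangMills.Theorems.N21ResponseRungNumeralAtThm1Letters (responseLetters_of_chart)
open Summit.QuantumFields.YangMills.Theorems.N21ExponentialChartFieldStrength
  (bond_letters_of_near_units plaqReading_sub_le_of_units isUnit_blockExpChart_apply norm_blockExpChart_apply_le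
    norm_inverse_blockExpChart_apply_le differentiableOn_plaqReading)
open Summit.QuantumFields.YangMills.Theorems.N21AnalyticResponseRemainder
  (norm_realToComplex_pi hRT_of_analyticResponse slotAntiConcentration_restrict_of_projectedCentre_analyticResponse)

variable {𝔄 : Type*} [NormedRing 𝔄] [NormedAlgebra ℂ 𝔄] [CompleteSpace 𝔄] [NormOneClass 𝔄]
  {κ B : Type*} [Fintype κ] [Fintype B]

/-! ## §1  File 7's field-strength letter with constants read at a bound `ϱ ≥ ‖x‖` -/

/-- ★ **THE FIELD-STRENGTH LETTER, UNIFORM OVER THE CUT**: file 7's `fieldStrength_closedBall_blockExpChart` with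
`e^{‖x‖Ξ}` replaced by `e^{ϱΞ}` for `‖x‖ ≤ ϱ` — every `V ∈ closedBall (χ x) R` has unit bond variables and
`‖∂V(p) − 1‖ ≤ δ + c̄(ϱ, R)·R` on `plaqs`, `c̄ = max(e^{ϱΞ}v + R, 2v′e^{ϱΞ})³(2 + 4(v′e^{ϱΞ})²)`, provided
`R·v′e^{ϱΞ} ≤ ½` and `‖∂χ(x)(p) − 1‖ ≤ δ` on `plaqs`. [textbook] -/
theorem fieldStrength_closedBall_blockExpChart_of_norm_le (X : κ → B → 𝔄) (V₀ : B → 𝔄ˣ) {Ξ v v' R δ ϱ : ℝ}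
    (hΞ0 : 0 ≤ Ξ) (hΞ : ∀ b, ∑ a, ‖X a b‖ ≤ Ξ) (hv : ∀ b, ‖(V₀ b : 𝔄)‖ ≤ v)
    (hv' : ∀ b, ‖(↑(V₀ b)⁻¹ : 𝔄)‖ ≤ v') {x : κ → ℂ} (hx : ‖x‖ ≤ ϱ)
    (hR : R * (v' * Real.exp (ϱ * Ξ)) ≤ 1 / 2) (plaqs : Finset (B × B × B × B))
    (hδ : ∀ p ∈ plaqs, ‖exp (∑ a, x a • X a p.1) * (V₀ p.1 : 𝔄) * (exp (∑ a, x a • X a p.2.1) * (V₀ p.2.1 : 𝔄)) *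
        Ring.inverse (exp (∑ a, x a • X a p.2.2.1) * (V₀ p.2.2.1 : 𝔄)) *
        Ring.inverse (exp (∑ a, x a • X a p.2.2.2) * (V₀ p.2.2.2 : 𝔄)) - 1‖ ≤ δ) :
    ∀ V ∈ closedBall (fun b => exp (∑ a, x a • X a b) * (V₀ b : 𝔄)) R,
      (∀ b, IsUnit (V b)) ∧ ∀ p ∈ plaqs,
        ‖V p.1 * V p.2.1 * Ring.inverse (V p.2.2.1) * Ring.inverse (V p.2.2.2) - 1‖ ≤
          δ + max (Real.exp (ϱ * Ξ) * v + R) (2 * (v' * Real.exp (ϱ * Ξ))) ^ 3 *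
            (2 + 4 * (v' * Real.exp (ϱ * Ξ)) ^ 2) * R := by
  intro V hV
  rw [mem_closedBall, dist_eq_norm] at hV
  have hexp : Real.exp (‖x‖ * Ξ) ≤ Real.exp (ϱ * Ξ) := Real.exp_le_exp.2 (mul_le_mul_of_nonneg_right hx hΞ0)
  have hU : ∀ b, IsUnit ((fun b => exp (∑ a, x a • X a b) * (V₀ b : 𝔄)) b) := fun b =>
    isUnit_blockExpChart_apply X V₀ x b
  have hn : ∀ b, ‖(fun b => exp (∑ a, x a • X a b) * (V₀ b : 𝔄)) b‖ ≤ Real.exp (ϱ * Ξ) * v := fun b =>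
    (norm_blockExpChart_apply_le X V₀ hΞ hv x b).trans
      (mul_le_mul_of_nonneg_right hexp ((norm_nonneg _).trans (hv b)))
  have hn' : ∀ b, ‖Ring.inverse ((fun b => exp (∑ a, x a • X a b) * (V₀ b : 𝔄)) b)‖ ≤
      v' * Real.exp (ϱ * Ξ) := fun b =>
    (norm_inverse_blockExpChart_apply_le X V₀ hΞ hv' x b).trans
      (mul_le_mul_of_nonneg_left hexp ((norm_nonneg _).trans (hv' b)))
  refine ⟨fun b => (bond_letters_of_near_units hU hn hn' hV hR b).1, fun p hp => ?_⟩
  have hL := plaqReading_sub_le_of_units hU hn hn' hV hR p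
  have hb := hδ p hp
  calc ‖V p.1 * V p.2.1 * Ring.inverse (V p.2.2.1) * Ring.inverse (V p.2.2.2) - 1‖
      = ‖(V p.1 * V p.2.1 * Ring.inverse (V p.2.2.1) * Ring.inverse (V p.2.2.2) -
          exp (∑ a, x a • X a p.1) * (V₀ p.1 : 𝔄) * (exp (∑ a, x a • X a p.2.1) * (V₀ p.2.1 : 𝔄)) *
            Ring.inverse (exp (∑ a, x a • X a p.2.2.1) * (V₀ p.2.2.1 : 𝔄)) *
            Ring.inverse (exp (∑ a, x a • X a p.2.2.2) * (V₀ p.2.2.2 : 𝔄))) +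
          (exp (∑ a, x a • X a p.1) * (V₀ p.1 : 𝔄) * (exp (∑ a, x a • X a p.2.1) * (V₀ p.2.1 : 𝔄)) *
            Ring.inverse (exp (∑ a, x a • X a p.2.2.1) * (V₀ p.2.2.1 : 𝔄)) *
            Ring.inverse (exp (∑ a, x a • X a p.2.2.2) * (V₀ p.2.2.2 : 𝔄)) - 1)‖ := by rw [sub_add_sub_cancel]
    _ ≤ max (Real.exp (ϱ * Ξ) * v + R) (2 * (v' * Real.exp (ϱ * Ξ))) ^ 3 *
            (2 + 4 * (v' * Real.exp (ϱ * Ξ)) ^ 2) * R + δ := (norm_add_le _ _).trans (add_le_add hL hb)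
    _ = _ := by ring

/-! ## §2  File 7's response letters with the uniform chart letters `ℓ̄`, `c̄` -/

/-- ★★ **RESPONSE LETTERS AT THE REGULAR SET, UNIFORM OVER THE CUT** (file 7 §6 read at `ϱ ≥ ‖x‖`): with
`ℓ̄ = Ξe^{(ϱ+r)Ξ}v`, `ℓ̄r·v′e^{ϱΞ} ≤ ½`, the budget `δ + c̄(ϱ, ℓ̄r)·ℓ̄r < ε`, base field strength `≤ δ` at `x`,
and `Ψ` differentiable on the regular set of radius `ε` with `‖Ψ‖ ≤ S` there: `Ψ ∘ χ` is complex differentiable on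
`ball x r` and maps it into `closedBall ((Ψ ∘ χ) x) (2S)` — file 2's `hd`, `hB` (`B = 2S`) at `x`. [textbook] -/
theorem responseLetters_of_blockExpChart_regular_of_norm_le {E : Type*} [NormedAddCommGroup E] [NormedSpace ℂ E]
    (X : κ → B → 𝔄) (V₀ : B → 𝔄ˣ) {Ξ v v' r S δ ε ϱ : ℝ} (hΞ0 : 0 ≤ Ξ) (hΞ : ∀ b, ∑ a, ‖X a b‖ ≤ Ξ)
    (hv0 : 0 ≤ v) (hv : ∀ b, ‖(V₀ b : 𝔄)‖ ≤ v) (hv' : ∀ b, ‖(↑(V₀ b)⁻¹ : 𝔄)‖ ≤ v') (hr : 0 < r)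
    {x : κ → ℂ} (hx : ‖x‖ ≤ ϱ)
    (hsmall : Ξ * Real.exp ((ϱ + r) * Ξ) * v * r * (v' * Real.exp (ϱ * Ξ)) ≤ 1 / 2)
    (plaqs : Finset (B × B × B × B))
    (hδ : ∀ p ∈ plaqs, ‖exp (∑ a, x a • X a p.1) * (V₀ p.1 : 𝔄) * (exp (∑ a, x a • X a p.2.1) * (V₀ p.2.1 : 𝔄)) *
        Ring.inverse (exp (∑ a, x a • X a p.2.2.1) * (V₀ p.2.2.1 : 𝔄)) *
        Ring.inverse (exp (∑ a, x a • X a p.2.2.2) * (V₀ p.2.2.2 : 𝔄)) - 1‖ ≤ δ)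
    (hbudget : δ + max (Real.exp (ϱ * Ξ) * v + Ξ * Real.exp ((ϱ + r) * Ξ) * v * r)
        (2 * (v' * Real.exp (ϱ * Ξ))) ^ 3 * (2 + 4 * (v' * Real.exp (ϱ * Ξ)) ^ 2) *
        (Ξ * Real.exp ((ϱ + r) * Ξ) * v * r) < ε)
    (Ψ : (B → 𝔄) → E)
    (hΨd : DifferentiableOn ℂ Ψ {V : B → 𝔄 | (∀ b, IsUnit (V b)) ∧ ∀ p ∈ plaqs,
      ‖V p.1 * V p.2.1 * Ring.inverse (V p.2.2.1) * Ring.inverse (V p.2.2.2) - 1‖ < ε})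
    (hΨS : ∀ V ∈ {V : B → 𝔄 | (∀ b, IsUnit (V b)) ∧ ∀ p ∈ plaqs,
      ‖V p.1 * V p.2.1 * Ring.inverse (V p.2.2.1) * Ring.inverse (V p.2.2.2) - 1‖ < ε}, ‖Ψ V‖ ≤ S) :
    DifferentiableOn ℂ (Ψ ∘ fun w : κ → ℂ => fun b => exp (∑ a, w a • X a b) * (V₀ b : 𝔄)) (ball x r) ∧
      MapsTo (Ψ ∘ fun w : κ → ℂ => fun b => exp (∑ a, w a • X a b) * (V₀ b : 𝔄)) (ball x r)
        (closedBall ((Ψ ∘ fun w : κ → ℂ => fun b => exp (∑ a, w a • X a b) * (V₀ b : 𝔄)) x) (2 * S)) := by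
  have hexp : Real.exp ((‖x‖ + r) * Ξ) ≤ Real.exp ((ϱ + r) * Ξ) :=
    Real.exp_le_exp.2 (mul_le_mul_of_nonneg_right (by linarith) hΞ0)
  have hℓ : Ξ * Real.exp ((‖x‖ + r) * Ξ) * v ≤ Ξ * Real.exp ((ϱ + r) * Ξ) * v :=
    mul_le_mul_of_nonneg_right (mul_le_mul_of_nonneg_left hexp hΞ0) hv0
  have hχℓ : ∀ w ∈ ball x r, ‖(fun b => exp (∑ a, w a • X a b) * (V₀ b : 𝔄)) -
      (fun b => exp (∑ a, x a • X a b) * (V₀ b : 𝔄))‖ ≤ Ξ * Real.exp ((ϱ + r) * Ξ) * v * ‖w - x‖ :=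
    fun w hw => (blockExpChart_lipschitz X (fun b => (V₀ b : 𝔄)) hΞ0 hΞ hv0 hv x w hw).trans
      (mul_le_mul_of_nonneg_right hℓ (norm_nonneg _))
  refine responseLetters_of_chart (fun w : κ → ℂ => fun b => exp (∑ a, w a • X a b) * (V₀ b : 𝔄)) Ψ hr
    (by positivity) (differentiable_blockExpChart X fun b => (V₀ b : 𝔄)).differentiableOn hχℓ ?_ hΨd hΨS
  intro V hV
  obtain ⟨hU, hP⟩ := fieldStrength_closedBall_blockExpChart_of_norm_le X V₀ hΞ0 hΞ hv hv' hx hsmall plaqs hδ V hV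
  exact ⟨hU, fun p hp => (hP p hp).trans_lt hbudget⟩

/-! ## §3  Part 34's radial-transversality binder `hRT` through the exponential block chart -/

section Junction

variable {Z P E : Type*} [NormedAddCommGroup E] [NormedSpace ℂ E]

/-- the cut letters `hd`, `hB` of file 2 at EVERY cut point, from the NODE-O-shaped clause through the chart
(§2 at `x := ι x`, `‖ι x‖ = ‖x‖ ≤ ϱ`). [bookkeeping] -/
theorem cutLetters_of_blockExpChart_regular (Xd : Z → κ → B → 𝔄) (V₀ : Z → B → 𝔄ˣ)
    {Ξ v v' r S δ ε ϱ : ℝ} (hΞ0 : 0 ≤ Ξ) (hΞ : ∀ z b, ∑ a, ‖Xd z a b‖ ≤ Ξ) (hv0 : 0 ≤ v)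
    (hv : ∀ z b, ‖(V₀ z b : 𝔄)‖ ≤ v) (hv' : ∀ z b, ‖(↑(V₀ z b)⁻¹ : 𝔄)‖ ≤ v') (hr : 0 < r)
    (hsmall : Ξ * Real.exp ((ϱ + r) * Ξ) * v * r * (v' * Real.exp (ϱ * Ξ)) ≤ 1 / 2)
    (plaqs : Finset (B × B × B × B))
    (hbudget : δ + max (Real.exp (ϱ * Ξ) * v + Ξ * Real.exp ((ϱ + r) * Ξ) * v * r)
        (2 * (v' * Real.exp (ϱ * Ξ))) ^ 3 * (2 + 4 * (v' * Real.exp (ϱ * Ξ)) ^ 2) *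
        (Ξ * Real.exp ((ϱ + r) * Ξ) * v * r) < ε)
    (Ψ : P → Z → (B → 𝔄) → E)
    (hΨd : ∀ q z, DifferentiableOn ℂ (Ψ q z) {V : B → 𝔄 | (∀ b, IsUnit (V b)) ∧ ∀ p ∈ plaqs,
      ‖V p.1 * V p.2.1 * Ring.inverse (V p.2.2.1) * Ring.inverse (V p.2.2.2) - 1‖ < ε})
    (hΨS : ∀ q z, ∀ V ∈ {V : B → 𝔄 | (∀ b, IsUnit (V b)) ∧ ∀ p ∈ plaqs,
      ‖V p.1 * V p.2.1 * Ring.inverse (V p.2.2.1) * Ring.inverse (V p.2.2.2) - 1‖ < ε}, ‖Ψ q z V‖ ≤ S)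
    (K : Z → Set (κ → ℝ)) (hKϱ : ∀ z, ∀ x ∈ K z, ‖x‖ ≤ ϱ)
    (hreg : ∀ z, ∀ x ∈ K z, ∀ p ∈ plaqs,
      ‖exp (∑ a, (x a : ℂ) • Xd z a p.1) * (V₀ z p.1 : 𝔄) * (exp (∑ a, (x a : ℂ) • Xd z a p.2.1) * (V₀ z p.2.1 : 𝔄)) *
        Ring.inverse (exp (∑ a, (x a : ℂ) • Xd z a p.2.2.1) * (V₀ z p.2.2.1 : 𝔄)) *
        Ring.inverse (exp (∑ a, (x a : ℂ) • Xd z a p.2.2.2) * (V₀ z p.2.2.2 : 𝔄)) - 1‖ ≤ δ) :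
    (∀ q z, ∀ x ∈ K z, DifferentiableOn ℂ
        (fun w : κ → ℂ => Ψ q z (fun b => exp (∑ a, w a • Xd z a b) * (V₀ z b : 𝔄)))
        (ball (fun i => (x i : ℂ)) r)) ∧
      ∀ q z, ∀ x ∈ K z, MapsTo (fun w : κ → ℂ => Ψ q z (fun b => exp (∑ a, w a • Xd z a b) * (V₀ z b : 𝔄)))
        (ball (fun i => (x i : ℂ)) r)
        (closedBall (Ψ q z (fun b => exp (∑ a, (x a : ℂ) • Xd z a b) * (V₀ z b : 𝔄))) (2 * S)) := by
  have h := fun q z x (hx : x ∈ K z) =>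
    responseLetters_of_blockExpChart_regular_of_norm_le (Xd z) (V₀ z) hΞ0 (hΞ z) hv0 (hv z) (hv' z) hr
      (x := fun i => (x i : ℂ)) (by rw [norm_realToComplex_pi]; exact hKϱ z x hx) hsmall plaqs (hreg z x hx)
      hbudget (Ψ q z) (hΨd q z) (hΨS q z)
  exact ⟨fun q z x hx => (h q z x hx).1, fun q z x hx => (h q z x hx).2⟩

/-- ★★★ **PART 34's `hRT` FOR THE CUBE SUP OF PLAQUETTE READINGS OF THE MINIMISER THROUGH THE EXPONENTIAL BLOCK
CHART** (file 2 ★ `hRT_of_analyticResponse` with `hd`, `hB` DISCHARGED by §2 at every cut point, `B = 2S`): from the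
NODE-O-shaped clause (`Ψ q z` differentiable on the regular set of radius `ε` with `‖Ψ q z‖ ≤ S`, every fine
plaquette `q`, every exterior `z`), the chart data (uniform `Ξ, v, v′`), the cut bound `‖x‖ ≤ ϱ` on `K z`,
`δ`-regularity of the base configurations `χ_z(ι x)` at the cut points, SMALLNESS and BUDGET at `ϱ`, and file 2's
cut letters (`c z ∈ K z ⊆ closedBall (c z) R`, `2R < r`, core reading `≤ c₀`, `C ⊆ {p.2 ∈ K p.1}`) with the numeral
`c₀ + 4(2·(2S)∕r²)R² ≤ (1 − κ₀)θ(1 − ρ)`: part 34's binder VERBATIM for `U p = ⨆_q ‖Ψ q p.1 (χ_{p.1}(ι p.2))‖`.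
[textbook] -/
theorem hRT_of_blockExpChart_regular [CompleteSpace E] [Fintype P] [Nonempty P] (Xd : Z → κ → B → 𝔄) (V₀ : Z → B → 𝔄ˣ)
    {Ξ v v' r S δ ε ϱ R c₀ θ ρ κ₀ : ℝ} (hΞ0 : 0 ≤ Ξ) (hΞ : ∀ z b, ∑ a, ‖Xd z a b‖ ≤ Ξ) (hv0 : 0 ≤ v)
    (hv : ∀ z b, ‖(V₀ z b : 𝔄)‖ ≤ v) (hv' : ∀ z b, ‖(↑(V₀ z b)⁻¹ : 𝔄)‖ ≤ v') (hr : 0 < r) (hS0 : 0 ≤ S)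
    (hsmall : Ξ * Real.exp ((ϱ + r) * Ξ) * v * r * (v' * Real.exp (ϱ * Ξ)) ≤ 1 / 2)
    (plaqs : Finset (B × B × B × B))
    (hbudget : δ + max (Real.exp (ϱ * Ξ) * v + Ξ * Real.exp ((ϱ + r) * Ξ) * v * r)
        (2 * (v' * Real.exp (ϱ * Ξ))) ^ 3 * (2 + 4 * (v' * Real.exp (ϱ * Ξ)) ^ 2) *
        (Ξ * Real.exp ((ϱ + r) * Ξ) * v * r) < ε)
    (Ψ : P → Z → (B → 𝔄) → E)
    (hΨd : ∀ q z, DifferentiableOn ℂ (Ψ q z) {V : B → 𝔄 | (∀ b, IsUnit (V b)) ∧ ∀ p ∈ plaqs,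
      ‖V p.1 * V p.2.1 * Ring.inverse (V p.2.2.1) * Ring.inverse (V p.2.2.2) - 1‖ < ε})
    (hΨS : ∀ q z, ∀ V ∈ {V : B → 𝔄 | (∀ b, IsUnit (V b)) ∧ ∀ p ∈ plaqs,
      ‖V p.1 * V p.2.1 * Ring.inverse (V p.2.2.1) * Ring.inverse (V p.2.2.2) - 1‖ < ε}, ‖Ψ q z V‖ ≤ S)
    (K : Z → Set (κ → ℝ)) (hKϱ : ∀ z, ∀ x ∈ K z, ‖x‖ ≤ ϱ)
    (hreg : ∀ z, ∀ x ∈ K z, ∀ p ∈ plaqs,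
      ‖exp (∑ a, (x a : ℂ) • Xd z a p.1) * (V₀ z p.1 : 𝔄) * (exp (∑ a, (x a : ℂ) • Xd z a p.2.1) * (V₀ z p.2.1 : 𝔄)) *
        Ring.inverse (exp (∑ a, (x a : ℂ) • Xd z a p.2.2.1) * (V₀ z p.2.2.1 : 𝔄)) *
        Ring.inverse (exp (∑ a, (x a : ℂ) • Xd z a p.2.2.2) * (V₀ z p.2.2.2 : 𝔄)) - 1‖ ≤ δ)
    (c : Z → (κ → ℝ)) (hcK : ∀ z, c z ∈ K z) (hKR : ∀ z, ∀ w ∈ K z, ‖w - c z‖ ≤ R) (hRr : 2 * R < r)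
    (hc₀ : ∀ q z, ‖Ψ q z (fun b => exp (∑ a, ((c z a : ℝ) : ℂ) • Xd z a b) * (V₀ z b : 𝔄))‖ ≤ c₀)
    {C : Set (Z × (κ → ℝ))} (hCK : ∀ p ∈ C, p.2 ∈ K p.1)
    (hnum : c₀ + 4 * (2 * (2 * S) / r ^ 2) * R ^ 2 ≤ (1 - κ₀) * (θ * (1 - ρ))) :
    ∀ p : Z × (κ → ℝ), θ * (1 - ρ) ≤ (⨆ q, ‖Ψ q p.1 (fun b => exp (∑ a, ((p.2 a : ℝ) : ℂ) • Xd p.1 a b) * (V₀ p.1 b : 𝔄))‖) → (⨆ q, ‖Ψ q p.1 (fun b => exp (∑ a, ((p.2 a : ℝ) : ℂ) • Xd p.1 a b) * (V₀ p.1 b : 𝔄))‖) < θ → p ∈ C → ∀ s : ℝ, 1 ≤ s →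
      θ * (1 - ρ) ≤ (⨆ q, ‖Ψ q p.1 (fun b => exp (∑ a, (((c p.1 + s • (p.2 - c p.1)) a : ℝ) : ℂ) • Xd p.1 a b) * (V₀ p.1 b : 𝔄))‖) → (⨆ q, ‖Ψ q p.1 (fun b => exp (∑ a, (((c p.1 + s • (p.2 - c p.1)) a : ℝ) : ℂ) • Xd p.1 a b) * (V₀ p.1 b : 𝔄))‖) < θ → (p.1, c p.1 + s • (p.2 - c p.1)) ∈ C →
        (⨆ q, ‖Ψ q p.1 (fun b => exp (∑ a, ((p.2 a : ℝ) : ℂ) • Xd p.1 a b) * (V₀ p.1 b : 𝔄))‖) + κ₀ * (θ * (1 - ρ)) * (s - 1) ≤ (⨆ q, ‖Ψ q p.1 (fun b => exp (∑ a, (((c p.1 + s • (p.2 - c p.1)) a : ℝ) : ℂ) • Xd p.1 a b) * (V₀ p.1 b : 𝔄))‖) := by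
  obtain ⟨hd, hB⟩ := cutLetters_of_blockExpChart_regular Xd V₀ hΞ0 hΞ hv0 hv hv' hr hsmall plaqs hbudget Ψ hΨd hΨS K
    hKϱ hreg
  exact hRT_of_analyticResponse (fun q z w => Ψ q z fun b => exp (∑ a, w a • Xd z a b) * (V₀ z b : 𝔄)) K c
    (B := 2 * S) (by positivity) hd hB hcK hKR hRr hc₀ hCK hnum

/-! ## §4  Part 34's (M1) through the exponential block chart -/

/-- ★★★★ **(M1) ON THE CUT LAW ABOUT THE A-PROJECTED CENTRE FOR THE CUBE SUP OF PLAQUETTE READINGS OF THE MINIMISER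
THROUGH THE EXPONENTIAL BLOCK CHART** (file 2 ★★ ∕ part 34 with `hRT`'s response letters DISCHARGED from the
NODE-O-shaped clause at the regular set; the remaining binders — coercivity `γ`, Lipschitz cut action `G`,
obtuseness, farness, envelope, odds `Q`, measurability — displayed unchanged).  LOCATED junction; A2: the joint system
of part 34 is not exhibited here (its displayed binders have their own sanity files), §5 inhabits the NODE-O clause.
[textbook] -/
theorem slotAntiConcentration_restrict_of_projectedCentre_blockExpChart_regular [CompleteSpace E] [Fintype P]
    [Nonempty P] [MeasurableSpace Z] [Nonempty κ]
    (ζ : Measure Z) [SFinite ζ] (A : Matrix κ κ ℝ) (hA : A.IsSymm) {γ G : ℝ} (hγ0 : 0 < γ)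
    (hγ : ∀ x : κ → ℝ, γ * ‖x‖ ^ 2 ≤ x ⬝ᵥ (A *ᵥ x))
    (m : Z → (κ → ℝ)) {c : Z → (κ → ℝ)} (hc : Measurable c) (Pz : Z → (κ → ℝ) → ℝ)
    (Xd : Z → κ → B → 𝔄) (V₀ : Z → B → 𝔄ˣ)
    {Ξ v v' r S δ ε ϱ R c₀ θ ρ κ₀ : ℝ} (hΞ0 : 0 ≤ Ξ) (hΞ : ∀ z b, ∑ a, ‖Xd z a b‖ ≤ Ξ) (hv0 : 0 ≤ v)
    (hv : ∀ z b, ‖(V₀ z b : 𝔄)‖ ≤ v) (hv' : ∀ z b, ‖(↑(V₀ z b)⁻¹ : 𝔄)‖ ≤ v') (hr : 0 < r) (hS0 : 0 ≤ S)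
    (hsmall : Ξ * Real.exp ((ϱ + r) * Ξ) * v * r * (v' * Real.exp (ϱ * Ξ)) ≤ 1 / 2)
    (plaqs : Finset (B × B × B × B))
    (hbudget : δ + max (Real.exp (ϱ * Ξ) * v + Ξ * Real.exp ((ϱ + r) * Ξ) * v * r)
        (2 * (v' * Real.exp (ϱ * Ξ))) ^ 3 * (2 + 4 * (v' * Real.exp (ϱ * Ξ)) ^ 2) *
        (Ξ * Real.exp ((ϱ + r) * Ξ) * v * r) < ε)
    (Ψ : P → Z → (B → 𝔄) → E)
    (hΨd : ∀ q z, DifferentiableOn ℂ (Ψ q z) {V : B → 𝔄 | (∀ b, IsUnit (V b)) ∧ ∀ p ∈ plaqs,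
      ‖V p.1 * V p.2.1 * Ring.inverse (V p.2.2.1) * Ring.inverse (V p.2.2.2) - 1‖ < ε})
    (hΨS : ∀ q z, ∀ V ∈ {V : B → 𝔄 | (∀ b, IsUnit (V b)) ∧ ∀ p ∈ plaqs,
      ‖V p.1 * V p.2.1 * Ring.inverse (V p.2.2.1) * Ring.inverse (V p.2.2.2) - 1‖ < ε}, ‖Ψ q z V‖ ≤ S)
    (K : Z → Set (κ → ℝ)) (hKϱ : ∀ z, ∀ x ∈ K z, ‖x‖ ≤ ϱ)
    (hreg : ∀ z, ∀ x ∈ K z, ∀ p ∈ plaqs,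
      ‖exp (∑ a, (x a : ℂ) • Xd z a p.1) * (V₀ z p.1 : 𝔄) * (exp (∑ a, (x a : ℂ) • Xd z a p.2.1) * (V₀ z p.2.1 : 𝔄)) *
        Ring.inverse (exp (∑ a, (x a : ℂ) • Xd z a p.2.2.1) * (V₀ z p.2.2.1 : 𝔄)) *
        Ring.inverse (exp (∑ a, (x a : ℂ) • Xd z a p.2.2.2) * (V₀ z p.2.2.2 : 𝔄)) - 1‖ ≤ δ)
    (hg : Measurable fun p : Z × (κ → ℝ) => (K p.1).indicator (fun w => ENNReal.ofReal (Real.exp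
        (-(1 / 2 * ((w - m p.1) ⬝ᵥ (A *ᵥ (w - m p.1))) + Pz p.1 w)))) p.2)
    (hKR : ∀ z, ∀ w ∈ K z, ‖w - c z‖ ≤ R) (hRr : 2 * R < r)
    (hc₀ : ∀ q z, ‖Ψ q z (fun b => exp (∑ a, ((c z a : ℝ) : ℂ) • Xd z a b) * (V₀ z b : 𝔄))‖ ≤ c₀)
    (hUm : Measurable fun p : Z × (κ → ℝ) => (⨆ q, ‖Ψ q p.1 (fun b => exp (∑ a, ((p.2 a : ℝ) : ℂ) • Xd p.1 a b) * (V₀ p.1 b : 𝔄))‖))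
    {C Env : Set (Z × (κ → ℝ))} (hC : MeasurableSet C) (hEnv : MeasurableSet Env)
    (hCK : ∀ p ∈ C, p.2 ∈ K p.1)
    {Q : ℝ} (hθ : 0 < θ) (hρ0 : 0 < ρ) (hρ1 : ρ < 1) (hκ : 0 < κ₀) (hQ0 : 0 ≤ Q)
    (hnum : c₀ + 4 * (2 * (2 * S) / r ^ 2) * R ^ 2 ≤ (1 - κ₀) * (θ * (1 - ρ)))
    (hK : ∀ z, Convex ℝ (K z)) (hcK : ∀ z, c z ∈ K z)
    (hP : ∀ z, ∀ v ∈ K z, ∀ v' ∈ K z, Pz z v - Pz z v' ≤ G * ‖v - v'‖)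
    (hobt : ∀ p : Z × (κ → ℝ), θ * (1 - ρ) ≤ (⨆ q, ‖Ψ q p.1 (fun b => exp (∑ a, ((p.2 a : ℝ) : ℂ) • Xd p.1 a b) * (V₀ p.1 b : 𝔄))‖) → (⨆ q, ‖Ψ q p.1 (fun b => exp (∑ a, ((p.2 a : ℝ) : ℂ) • Xd p.1 a b) * (V₀ p.1 b : 𝔄))‖) < θ → p ∈ C →
      p.2 ∈ K p.1 → 0 ≤ (c p.1 - m p.1) ⬝ᵥ (A *ᵥ (p.2 - c p.1)))
    (hfar : ∀ p : Z × (κ → ℝ), θ * (1 - ρ) ≤ (⨆ q, ‖Ψ q p.1 (fun b => exp (∑ a, ((p.2 a : ℝ) : ℂ) • Xd p.1 a b) * (V₀ p.1 b : 𝔄))‖) → (⨆ q, ‖Ψ q p.1 (fun b => exp (∑ a, ((p.2 a : ℝ) : ℂ) • Xd p.1 a b) * (V₀ p.1 b : 𝔄))‖) < θ → p ∈ C →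
      p.2 ∈ K p.1 → 2 * G ≤ γ * ‖p.2 - c p.1‖)
    (henv : ∀ l ∈ Icc (1 - 1 / ((Fintype.card κ : ℝ) + 1)) 1, ∀ p : Z × (κ → ℝ),
      θ * (1 - ρ) ≤ (⨆ q, ‖Ψ q p.1 (fun b => exp (∑ a, ((p.2 a : ℝ) : ℂ) • Xd p.1 a b) * (V₀ p.1 b : 𝔄))‖) → (⨆ q, ‖Ψ q p.1 (fun b => exp (∑ a, ((p.2 a : ℝ) : ℂ) • Xd p.1 a b) * (V₀ p.1 b : 𝔄))‖) < θ → p ∈ C → (p.1, c p.1 + l • (p.2 - c p.1)) ∈ Env)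
    (hQ : ((ζ.prod volume).withDensity fun p : Z × (κ → ℝ) => (K p.1).indicator (fun w => ENNReal.ofReal (Real.exp
        (-(1 / 2 * ((w - m p.1) ⬝ᵥ (A *ᵥ (w - m p.1))) + Pz p.1 w)))) p.2) (Env \ ({p | (⨆ q, ‖Ψ q p.1 (fun b => exp (∑ a, ((p.2 a : ℝ) : ℂ) • Xd p.1 a b) * (V₀ p.1 b : 𝔄))‖) < θ} ∩ C))
      ≤ ENNReal.ofReal Q * ((ζ.prod volume).withDensity fun p : Z × (κ → ℝ) => (K p.1).indicator (fun w => ENNReal.ofReal (Real.exp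
        (-(1 / 2 * ((w - m p.1) ⬝ᵥ (A *ᵥ (w - m p.1))) + Pz p.1 w)))) p.2) ({p | (⨆ q, ‖Ψ q p.1 (fun b => exp (∑ a, ((p.2 a : ℝ) : ℂ) • Xd p.1 a b) * (V₀ p.1 b : 𝔄))‖) < θ} ∩ C)) :
    SlotAntiConcentration
      ((((ζ.prod volume).withDensity fun p : Z × (κ → ℝ) => (K p.1).indicator (fun w => ENNReal.ofReal (Real.exp
        (-(1 / 2 * ((w - m p.1) ⬝ᵥ (A *ᵥ (w - m p.1))) + Pz p.1 w)))) p.2)).restrict ({p | (⨆ q, ‖Ψ q p.1 (fun b => exp (∑ a, ((p.2 a : ℝ) : ℂ) • Xd p.1 a b) * (V₀ p.1 b : 𝔄))‖) < θ} ∩ C))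
      (fun p : Z × (κ → ℝ) => (⨆ q, ‖Ψ q p.1 (fun b => exp (∑ a, ((p.2 a : ℝ) : ℂ) • Xd p.1 a b) * (V₀ p.1 b : 𝔄))‖)) θ ρ (3 * ((Fintype.card κ : ℝ) + 1) * (1 + Q) / (κ₀ * (1 - ρ))) := by
  obtain ⟨hd, hB⟩ := cutLetters_of_blockExpChart_regular Xd V₀ hΞ0 hΞ hv0 hv hv' hr hsmall plaqs hbudget Ψ hΨd hΨS K
    hKϱ hreg
  exact slotAntiConcentration_restrict_of_projectedCentre_analyticResponse ζ K A hA hγ0 hγ m hc Pz hg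
    (fun q z w => Ψ q z fun b => exp (∑ a, w a • Xd z a b) * (V₀ z b : 𝔄)) (B := 2 * S) (by positivity) hd hB
    hKR hRr hc₀ hUm hC hEnv hCK hθ hρ0 hρ1 hκ hQ0 hnum hK hcK hP hobt hfar henv hQ

end Junction

/-! ## §5  A2∕A6: the NODE-O-shaped clause is inhabited non-trivially — the field strength itself -/

omit [NormOneClass 𝔄] [Fintype κ] in
/-- **A2∕A6 — THE FIELD STRENGTH IS AN ADMISSIBLE READING.**  For `p ∈ plaqs` the map `Ψ(V) = ∂V(p) − 1` is
complex differentiable on the regular set of radius `ε` (file 7 `differentiableOn_plaqReading`) with `‖Ψ‖ ≤ ε`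
there: the hypotheses `hΨd`, `hΨS` of §2–§4 are jointly inhabited, in every `𝔄`, by a non-constant reading — the
level-0 instance of the tested variable (the plaquette variables of the data themselves). [textbook] -/
theorem fieldStrength_reading_admissible (plaqs : Finset (B × B × B × B)) (ε : ℝ) {p : B × B × B × B}
    (hp : p ∈ plaqs) :
    DifferentiableOn ℂ (fun V : B → 𝔄 => V p.1 * V p.2.1 * Ring.inverse (V p.2.2.1) * Ring.inverse (V p.2.2.2) - 1)
        {V : B → 𝔄 | (∀ b, IsUnit (V b)) ∧ ∀ p ∈ plaqs,
      ‖V p.1 * V p.2.1 * Ring.inverse (V p.2.2.1) * Ring.inverse (V p.2.2.2) - 1‖ < ε} ∧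
      ∀ V ∈ {V : B → 𝔄 | (∀ b, IsUnit (V b)) ∧ ∀ p ∈ plaqs,
      ‖V p.1 * V p.2.1 * Ring.inverse (V p.2.2.1) * Ring.inverse (V p.2.2.2) - 1‖ < ε},
        ‖V p.1 * V p.2.1 * Ring.inverse (V p.2.2.1) * Ring.inverse (V p.2.2.2) - 1‖ ≤ ε :=
  ⟨((differentiableOn_plaqReading p).mono fun _ hV => hV.1).sub_const 1, fun _ hV => (hV.2 p hp).le⟩

/-! ## §6  The measurability binder `hUm` of §4 for the response statistic (g0 ASK candidate (iii)) -/

omit [CompleteSpace 𝔄] [NormOneClass 𝔄] [Fintype B] in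
/-- **`hUm` SUPPLIER**: if every plaquette response `p ↦ Ψ q p.1 (χ_{p.1}(ι p.2))` is (jointly) measurable on
`Z × (κ → ℝ)`, the tested variable `U p = ⨆_q ‖Ψ q p.1 (χ_{p.1}(ι p.2))‖` is measurable (finitely many fine
plaquettes `q`; Mathlib `Measurable.iSup` in `ℝ`). The joint measurability of the response is the located input
(in the application: continuity in the block variables, measurability in the exterior). [bookkeeping] -/
theorem measurable_cubeSup_blockExpChart {Z P E : Type*} [MeasurableSpace Z] [Countable P] [NormedAddCommGroup E]
    [MeasurableSpace E] [OpensMeasurableSpace E] (Xd : Z → κ → B → 𝔄) (V₀ : Z → B → 𝔄ˣ)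
    (Ψ : P → Z → (B → 𝔄) → E)
    (hΦm : ∀ q, Measurable fun p : Z × (κ → ℝ) =>
      Ψ q p.1 (fun b => exp (∑ a, ((p.2 a : ℝ) : ℂ) • Xd p.1 a b) * (V₀ p.1 b : 𝔄))) :
    Measurable fun p : Z × (κ → ℝ) =>
      ⨆ q, ‖Ψ q p.1 (fun b => exp (∑ a, ((p.2 a : ℝ) : ℂ) • Xd p.1 a b) * (V₀ p.1 b : 𝔄))‖ :=
  Measurable.iSup fun q => (hΦm q).norm

end Summit.QuantumFields.YangMills.Theorems.N21ResponseRoadAtRegularSet
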